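/-
Origin: expansion seat `prover-pub-hodgecm-own-mu-0`, handover #MU4 2026-08-21T06:05:11Z md5 599e637787fc (74 l.; NEW; «UARM» = «U» at hA∕hR := the two _holds, μ := @ArchSideTerm.muSlotZero; imports HodgeCM.Model.E2InstanceOGR21AEPISTR2DJWHHTCGU + 2 vendored _holds modules + HodgeCM.Model.ArchMuClosedForm (#MU1, RUN 72); 1 theorem; NAMES: perL_picardCM_r21AEOGISTR2DJWHHTCGUARM; worded (α-U) (F7)) (`HOME/pub-hodgecm-own-mu/onword/HodgeCM/Model/E2InstanceOGR21AEPISTR2DJWHHTCGUARM.lean`, md5 599e637787fc, 74 lines);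
landed by the gen-31 packager (p-g31) in gate run 73 as `HodgeCM/Model/E2InstanceOGR21AEPISTR2DJWHHTCGUARM.lean` (verbatim).
-/
/-
Origin: NAMED SINGLE-OWNER PROVER `prover-pub-hodgecm-own-mu-0` (unit pub-hodgecm-own-mu; BINDER-OWNERS row 6 `μ`), 2026-08-21. ON-WORD DRAFT «UARM» —
NOT TABLED (lead 1-g85 LEAD WORD (α-M) STATUS l.15191 (V7)/(V8): rides only if the coordinator words S6 on «UAR» and conditions (a)–(e) hold).
Generated from the PKG bytes of «U» = `HodgeCM/Model/E2InstanceOGR21AEPISTR2DJWHHTCGU.lean` (RUN 57) by `HOME/pub-hodgecm-own-mu/work/gen_uarm.py`: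
binders `hA`, `μ`, `hR` DROPPED; `hA := arapura2012_cor_15_4_6_holds`, `hR := deligneMilne1982_Thm_6_20_full_holds` (vendored kernel proofs — the two
substitutions of glue-1-g12's certified «UAR» e89e031cdd05), `μ := @ArchSideTerm.muSlotZero` (own-mu #MU1; «U» sharpens it internally to
`μ₀ = muSharp₂₃ @muSlotZero = (0, slotDelta, slotDelta₂, slotDelta₃)(c.D)` — 12 sites, the SAME table «ARM» feeds E of record raw).
Target in PKG (if worded): `HodgeCM/Model/E2InstanceOGR21AEPISTR2DJWHHTCGUARM.lean` (NEW additive KERNEL leaf beside «U»; imports «U» + the two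
vendored `_holds` modules + own-mu `Model/ArchMuClosedForm`).  KERNEL ONLY: 1 theorem; 0 records, nothing cited, 0 `def … : Prop`, MODEL-N ±0 as a file.
Nothing here is a claim of the manuscripts under adjudication.
-/
import Summits.HodgeConjecture.HodgeCM.Model.E2InstanceOGR21AEPISTR2DJWHHTCGU
import Literature.NumberTheory.Transcendental.AnalytificationMorphismsProofs
import Literature.AlgebraicGeometry.HodgeTheory.AbelianVarietyHodgeFullnessHolds
import Summits.HodgeConjecture.HodgeCM.Model.ArchMuClosedForm

/-!
# E2InstanceOGR21AEPISTR2DJWHHTCGUARM — «U» AT THE TWO AUDITED `_holds` STRIKES AND AT ROW 6's CLOSED FORM: **2 groups `hGRU hΘ`**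

`perL_picardCM_r21AEOGISTR2DJWHHTCGUARM` = «U» `perL_picardCM_r21AEOGISTR2DJWHHTCGU` (5 groups `hA hGRU μ hR hΘ`) at
`hA := arapura2012_cor_15_4_6_holds`, `hR := deligneMilne1982_Thm_6_20_full_holds`, `μ := @ArchSideTerm.muSlotZero`.
Result: CITE 1 (`hGRU` = [GR91 Prop. 3.1.1] at every constructed CM dual-pair datum) + PROVE 1 (`hΘ`, row 9, stated at the pin terms with the
slot table `μ₀`); no DATA group.  One application, no tactic.  Conclusion unchanged.
-/

noncomputable section

open scoped TensorProduct InnerProductSpace Matrix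

open Literature.NumberTheory.Automorphic Literature.NumberTheory.Weil1964
open Literature.NumberTheory.GelbartRogawski1991.UnitaryDualPair
open HodgeCM.Adelic HodgeCM.PerL34
open scoped Classical
open Literature.Geometry.ComplexHyperbolic.BallModel (U21 x₀ stabilizerEquivK21)
open Literature.NumberTheory.Automorphic.U21 (K21 matA sclD)

namespace HodgeCM

namespace Model

open HodgeCM.Model.ArchSideTerm
open HodgeCM.Universe (AdelicThetaCore AdelicThetaCore₀ SideData ThetaModel ModelAxiomsPerL)
open Literature.AlgebraicGeometry.HodgeTheory
open Literature.AlgebraicGeometry.ComplexMultiplication (Shimura1998_Thm3_isogenousPower Shimura1998_Thm2_Cor)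
open Literature.NumberTheory.Automorphic.PicardCM
open Literature.NumberTheory.Transcendental (Arapura2012_Cor_15_4_6 arapura2012_cor_15_4_6_holds)
open HodgeCM.CMTypeOps (inflate)
open HodgeCM.Model.SupplyResidual (ClassSupplyPackN)
open HodgeCM.Model.ThetaSpace

variable (hHD : exists_isReal_hodgeModel) (hI : hodgePQ_independent_of_hodgeModel)
  (h₁ : BallQuotientUniformised)  (h₃ : CMAbelianVarietyEigenbasisRealised)

/-- **«UARM» (own-mu, ON-WORD)**: «U» at `hA := arapura2012_cor_15_4_6_holds`, `hR := deligneMilne1982_Thm_6_20_full_holds`, `μ := @ArchSideTerm.muSlotZero`; 2 explicit binder groups `hGRU hΘ`; ONE application of «U». -/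
theorem perL_picardCM_r21AEOGISTR2DJWHHTCGUARM
    (hGRU : ∀ (L : Type) [Field L] [NumberField L] [NumberField.IsCMField L] {N M n : ℕ} (e : Fin N × Fin M ≃ Fin n)
      (dV : Fin N → L) (hdV : ∀ i, NumberField.IsCMField.complexConj L (dV i) = dV i) (hdV0 : ∀ i, dV i ≠ 0)
      (dW : Fin M → L) (hdW : ∀ i, NumberField.IsCMField.complexConj L (dW i) = dW i) (hdW0 : ∀ i, dW i ≠ 0),
      (cmSplittingDatum L e dV hdV hdV0 dW hdW hdW0).CompatibleSplitting)
    (hΘ : ∀ {L : CMField} {ι₁ : L →+* ℂ} (V : HermSpace3 L ι₁) (c : SeesawCtx L),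
      (thetaModelOf hHD hI h₁ (cmAbelianVarietyRealised_of_eigenbasis hHD hI h₃) (orientBitι L ι₁) (embOf hHD hI h₁ (cmAbelianVarietyRealised_of_eigenbasis hHD hI h₃)) (coverOf hHD hI h₁ (cmAbelianVarietyRealised_of_eigenbasis hHD hI h₃) arapura2012_cor_15_4_6_holds) (wmOfInput (HypCensus.Wcm (@SInstance.GRU.hGR hGRU) (EtaChi.η (@SInstance.χVR (@SInstance.GRU.hGR hGRU) (@SInstance.GRU.hGR₀ hGRU) (@SInstance.GRU.hGR₁ hGRU)) (@SInstance.χWR (@SInstance.GRU.hGR hGRU) (@SInstance.GRU.hGR₀ hGRU) (@SInstance.GRU.hGR₁ hGRU) (ArchSideTerm.muSharp₂₃ @ArchSideTerm.muSlotZero))) (EtaChi.hη (@SInstance.χVR (@SInstance.GRU.hGR hGRU) (@SInstance.GRU.hGR₀ hGRU) (@SInstance.GRU.hGR₁ hGRU)) (@SInstance.χWR (@SInstance.GRU.hGR hGRU) (@SInstance.GRU.hGR₀ hGRU) (@SInstance.GRU.hGR₁ hGRU) (ArchSideTerm.muSharp₂₃ @ArchSideTerm.muSlotZero))) (EtaChi.hηc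 (@SInstance.χVR (@SInstance.GRU.hGR hGRU) (@SInstance.GRU.hGR₀ hGRU) (@SInstance.GRU.hGR₁ hGRU)) (@SInstance.χWR (@SInstance.GRU.hGR hGRU) (@SInstance.GRU.hGR₀ hGRU) (@SInstance.GRU.hGR₁ hGRU) (ArchSideTerm.muSharp₂₃ @ArchSideTerm.muSlotZero))))) (thetaOf _ (thetaClassInputOf _ (fun V c => thetaSpaceInputOf hHD hI h₁ (cmAbelianVarietyRealised_of_eigenbasis hHD hI h₃) (SInstance.SROGT'C (@SInstance.GRU.hGR hGRU) (@SInstance.GRU.hGR₀ hGRU) (@SInstance.GRU.hGR₁ hGRU) (@SInstance.GRU.hGR₂ hGRU) (@SInstance.GRU.hGR₃ hGRU) (ArchSideTerm.muSharp₂₃ @ArchSideTerm.muSlotZero) (ArchSideTerm.hΔ₁_GOG_muSharp₂₃ (@SInstance.GRU.hGR hGRU) (@SInstance.GRU.hGR₀ hGRU) (@SInstance.GRU.hGR₁ hGRU) (@SInstance.GRU.hGR₂ hGRU) (@SInstance.GRU.hGR₃ hGRU) @ArchSideTerm.muSlotZero) (ArchSideTerm.hΔ₂_GOG_muSharp₂₃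 (@SInstance.GRU.hGR hGRU) (@SInstance.GRU.hGR₀ hGRU) (@SInstance.GRU.hGR₁ hGRU) (@SInstance.GRU.hGR₂ hGRU) (@SInstance.GRU.hGR₃ hGRU) @ArchSideTerm.muSlotZero (ArchSideTerm.hSV_holds (@SInstance.GRU.hGR hGRU))) (ArchSideTerm.hΔ₃_GOG_muSharp₂₃ (@SInstance.GRU.hGR hGRU) (@SInstance.GRU.hGR₀ hGRU) (@SInstance.GRU.hGR₁ hGRU) (@SInstance.GRU.hGR₂ hGRU) (@SInstance.GRU.hGR₃ hGRU) @ArchSideTerm.muSlotZero (ArchSideTerm.hSV_holds (@SInstance.GRU.hGR hGRU)))) V c))) (d12Of (ArchSideTerm.muSharp₂₃ @ArchSideTerm.muSlotZero)) (d34Of (ArchSideTerm.muSharp₂₃ @ArchSideTerm.muSlotZero))).GoodCtx ι₁ c → Module.finrank ℚ c.K = 6 ∧ IsNormalClosure ℚ c.K L ∧ (Module.finrank ℚ L = 24 ∨ Module.finrank ℚ L = 48) →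
      (NumberField.InfinitePlace.mk ι₁).embedding = ι₁ →
      ∀ i : Fin 4, ∃ Γ₀ : Level V, ∀ Γ ≤ Γ₀,
        ∃ D : CommonReflexInput c.K (c.Ψ i) c.σ,
          (thetaModelOf hHD hI h₁ (cmAbelianVarietyRealised_of_eigenbasis hHD hI h₃) (orientBitι L ι₁) (embOf hHD hI h₁ (cmAbelianVarietyRealised_of_eigenbasis hHD hI h₃)) (coverOf hHD hI h₁ (cmAbelianVarietyRealised_of_eigenbasis hHD hI h₃) arapura2012_cor_15_4_6_holds) (wmOfInput (HypCensus.Wcm (@SInstance.GRU.hGR hGRU) (EtaChi.η (@SInstance.χVR (@SInstance.GRU.hGR hGRU) (@SInstance.GRU.hGR₀ hGRU) (@SInstance.GRU.hGR₁ hGRU)) (@SInstance.χWR (@SInstance.GRU.hGR hGRU) (@SInstance.GRU.hGR₀ hGRU) (@SInstance.GRU.hGR₁ hGRU) (ArchSideTerm.muSharp₂₃ @ArchSideTerm.muSlotZero))) (EtaChi.hη (@SInstance.χVR (@SInstance.GRU.hGR hGRU) (@SInstance.GRU.hGR₀ hGRU) (@SInstance.GRU.hGR₁ hGRU)) (@SInstance.χWR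 (@SInstance.GRU.hGR hGRU) (@SInstance.GRU.hGR₀ hGRU) (@SInstance.GRU.hGR₁ hGRU) (ArchSideTerm.muSharp₂₃ @ArchSideTerm.muSlotZero))) (EtaChi.hηc (@SInstance.χVR (@SInstance.GRU.hGR hGRU) (@SInstance.GRU.hGR₀ hGRU) (@SInstance.GRU.hGR₁ hGRU)) (@SInstance.χWR (@SInstance.GRU.hGR hGRU) (@SInstance.GRU.hGR₀ hGRU) (@SInstance.GRU.hGR₁ hGRU) (ArchSideTerm.muSharp₂₃ @ArchSideTerm.muSlotZero))))) (thetaOf _ (thetaClassInputOf _ (fun V c => thetaSpaceInputOf hHD hI h₁ (cmAbelianVarietyRealised_of_eigenbasis hHD hI h₃) (SInstance.SROGT'C (@SInstance.GRU.hGR hGRU) (@SInstance.GRU.hGR₀ hGRU) (@SInstance.GRU.hGR₁ hGRU) (@SInstance.GRU.hGR₂ hGRU) (@SInstance.GRU.hGR₃ hGRU) (ArchSideTerm.muSharp₂₃ @ArchSideTerm.muSlotZero) (ArchSideTerm.hΔ₁_GOG_muSharp₂₃ (@SInstance.GRU.hGR hGRU) (@SInstance.GRU.hGR₀ hGRU)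 (@SInstance.GRU.hGR₁ hGRU) (@SInstance.GRU.hGR₂ hGRU) (@SInstance.GRU.hGR₃ hGRU) @ArchSideTerm.muSlotZero) (ArchSideTerm.hΔ₂_GOG_muSharp₂₃ (@SInstance.GRU.hGR hGRU) (@SInstance.GRU.hGR₀ hGRU) (@SInstance.GRU.hGR₁ hGRU) (@SInstance.GRU.hGR₂ hGRU) (@SInstance.GRU.hGR₃ hGRU) @ArchSideTerm.muSlotZero (ArchSideTerm.hSV_holds (@SInstance.GRU.hGR hGRU))) (ArchSideTerm.hΔ₃_GOG_muSharp₂₃ (@SInstance.GRU.hGR hGRU) (@SInstance.GRU.hGR₀ hGRU) (@SInstance.GRU.hGR₁ hGRU) (@SInstance.GRU.hGR₂ hGRU) (@SInstance.GRU.hGR₃ hGRU) @ArchSideTerm.muSlotZero (ArchSideTerm.hSV_holds (@SInstance.GRU.hGR hGRU)))) V c))) (d12Of (ArchSideTerm.muSharp₂₃ @ArchSideTerm.muSlotZero)) (d34Of (ArchSideTerm.muSharp₂₃ @ArchSideTerm.muSlotZero))).Theta V c i Γ ⊆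
            Submodule.span ℂ (D.surfaceClasses hHD hI h₁ (cmAbelianVarietyRealised_of_eigenbasis hHD hI h₃) V Γ)) :
     (picardCMUniverse hHD hI h₁ (cmAbelianVarietyRealised_of_eigenbasis hHD hI h₃)).PerL
:=
  perL_picardCM_r21AEOGISTR2DJWHHTCGU hHD hI h₁ h₃ arapura2012_cor_15_4_6_holds hGRU @ArchSideTerm.muSlotZero
    deligneMilne1982_Thm_6_20_full_holds hΘ

end Model

end HodgeCM
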